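import Mathlib
import HarnessLib

/-!
# QUANT lane R8 tool: pairing against Poisson weights and the VERTEX LAW of the profile-conjecture assembly
# (pure finite-sum algebra for `Quant.HubBlocksProfileIneq`, census-1 PROFILE-PROOF-G10 §2–§4)

builds on p205010 (kernel theorem, internal audit signed; external expert review pending)

Support file (`--supports stmt-CriticalPhenomena-4575`), QUANT lane typer seat prim-quant-stmt (gen 15); step S3/S4 (algebraic part) of the assembly of
`Quant.HubBlocksProfileIneq` (`…QuantHubBlocksProfileConjecture.lean`).  Pure real algebra on finite sums; theorems only; no definitions, no sorries,
standard axioms.  The certificate `Quant.ratioRegular_expectation_ge` (`…QuantRatioRegularCertificate.lean`) asks, for a multiplier `ν`, that the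
Poisson-weighted tails `Σ_{i=t}^{n} (ℓ i − τ − ν(i − μ))·μ^i/i!` be nonnegative; PROFILE-PROOF-G10 proves this (CASE A, CASE B2) by bounding terms and
PAIRING a possibly negative term `i` with a positive partner `i' > i` of larger Poisson weight, and (CASE B1) by recognising the tail inequality for the
price `ν = (ℓ b* − τ)/(b* − μ)` as the conjecture itself for the VERTEX LAW `λ·Poisson(μ)|[t,n] ⊕ (1−λ)·δ_{b*}` — a ratio-regular law of mean `μ` on
`{0,…,b*}`, `b* < m`, whence induction on `m`.  This file supplies exactly these algebraic facts.

* `Quant.sum_nonneg_of_pairing` — a finite sum is `≥ 0` if its possibly negative terms are injectively paired with partners making each pair `≥ 0`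
  and every other term is `≥ 0`.
* `Quant.poissonWeight_pos`, `Quant.poissonWeight_mono` — `μ^i/i!` is positive and nondecreasing in `i` on `[0, μ]`;
  `Quant.pair_weighted_nonneg` — `0 ≤ e'`, `0 ≤ e + e'`, `0 ≤ w ≤ w'` ⟹ `0 ≤ w e + w' e'`.
* `Quant.vertexLaw_*` — for `t ≤ n ≤ μ < b*`, `n < b*`: the law `Y(i) = λ μ^i/(i! Z)` (`t ≤ i ≤ n`), `Y(b*) = 1 − λ`, `λ = (b* − μ)Z/(b* Z − M)`,
  `Z = Σ_{i=t}^{n} μ^i/i!`, `M = Σ_{i=t}^{n} i μ^i/i!`, is a probability law on `{0,…,b*}` with mean `μ`, ratio-regular below `μ`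
  (`vertexLaw_nonneg / _sum / _mean / _ratio`), its expectation of `ℓ` is `λ·(Σ w ℓ)/Z + (1−λ)·ℓ b*` (`vertexLaw_expectation`), and
  **`Quant.poissonTail_nonneg_of_vertexLaw`**: `τ ≤ E_Y ℓ` ⟹ `0 ≤ Σ_{i=t}^{n} (ℓ i − τ − U·(i − μ))·μ^i/i!` with `U = (ℓ b* − τ)/(b* − μ)`.
[this work]
-/

noncomputable section

namespace Summit.CriticalPhenomena.PercolationContinuityZ3.Theorems

namespace Quant

open Finset

/-! ### Pairing -/

/-- **Pairing.**  Let `S` be a finset, `N ⊆ S` the possibly negative indices, `φ` an injection on `N` into `S ∖ N` with `0 ≤ f i + f (φ i)` for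
`i ∈ N`, and `0 ≤ f i` for every `i ∈ S ∖ N`.  Then `0 ≤ Σ_{i∈S} f i`. [folklore] -/
theorem sum_nonneg_of_pairing (f : ℕ → ℝ) (S N : Finset ℕ) (φ : ℕ → ℕ) (hN : N ⊆ S)
    (hφS : ∀ i ∈ N, φ i ∈ S) (hφN : ∀ i ∈ N, φ i ∉ N) (hinj : ∀ i ∈ N, ∀ i' ∈ N, φ i = φ i' → i = i')
    (hpair : ∀ i ∈ N, 0 ≤ f i + f (φ i)) (hpos : ∀ i ∈ S, i ∉ N → 0 ≤ f i) :
    0 ≤ ∑ i ∈ S, f i := by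
  classical
  -- `S = N ∪ φ(N) ∪ R`
  set I : Finset ℕ := N.image φ with hI
  have hIS : I ⊆ S := fun x hx => by
    obtain ⟨i, hi, rfl⟩ := Finset.mem_image.1 hx; exact hφS i hi
  have hNI : Disjoint N I := by
    rw [Finset.disjoint_left]
    intro x hxN hxI
    obtain ⟨i, hi, hix⟩ := Finset.mem_image.1 hxI
    exact hφN i hi (hix ▸ hxN)
  have hsplit : ∑ i ∈ S, f i = ∑ i ∈ N, f i + ∑ i ∈ I, f i + ∑ i ∈ S \ (N ∪ I), f i := by
    rw [← Finset.sum_union hNI, ← Finset.sum_union Finset.disjoint_sdiff, Finset.union_sdiff_of_subset (Finset.union_subset hN hIS)]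
  have hI_sum : ∑ i ∈ I, f i = ∑ i ∈ N, f (φ i) := by
    rw [hI, Finset.sum_image]
    exact fun i hi i' hi' h => hinj i hi i' hi' h
  rw [hsplit, hI_sum, ← Finset.sum_add_distrib]
  refine add_nonneg (add_nonneg (Finset.sum_nonneg fun i hi => hpair i hi) le_rfl |>.trans_eq (by ring)) ?_
  refine Finset.sum_nonneg fun i hi => ?_
  rw [Finset.mem_sdiff, Finset.mem_union, not_or] at hi
  exact hpos i hi.1 hi.2.1

/-- `0 ≤ e'`, `0 ≤ e + e'`, `0 ≤ w ≤ w'` ⟹ `0 ≤ w·e + w'·e'`. [folklore] -/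
theorem pair_weighted_nonneg {e e' w w' : ℝ} (he' : 0 ≤ e') (hs : 0 ≤ e + e') (hw : 0 ≤ w) (hww : w ≤ w') : 0 ≤ w * e + w' * e' := by
  nlinarith [mul_nonneg (sub_nonneg.2 hww) he', mul_nonneg hw hs]

/-! ### Poisson weights -/

/-- `μ^i/i! > 0` for `μ > 0`. [folklore] -/
theorem poissonWeight_pos {μ : ℝ} (hμ : 0 < μ) (i : ℕ) : 0 < μ ^ i / (Nat.factorial i : ℝ) :=
  div_pos (pow_pos hμ i) (by exact_mod_cast Nat.factorial_pos i)

/-- One step: `μ^i/i! ≤ μ^(i+1)/(i+1)!` when `i + 1 ≤ μ`. [folklore] -/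
theorem poissonWeight_step {μ : ℝ} (hμ : 0 < μ) (i : ℕ) (hi : ((i : ℝ) + 1) ≤ μ) :
    μ ^ i / (Nat.factorial i : ℝ) ≤ μ ^ (i + 1) / (Nat.factorial (i + 1) : ℝ) := by
  have hf : (0 : ℝ) < (Nat.factorial i : ℝ) := by exact_mod_cast Nat.factorial_pos i
  have hf1 : (Nat.factorial (i + 1) : ℝ) = ((i : ℝ) + 1) * (Nat.factorial i : ℝ) := by
    rw [Nat.factorial_succ]; push_cast; ring
  rw [hf1, pow_succ, div_le_div_iff₀ hf (by positivity)]
  have hpow : 0 ≤ μ ^ i := pow_nonneg hμ.le i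
  nlinarith [mul_nonneg hpow hf.le, mul_nonneg (mul_nonneg hpow hf.le) (sub_nonneg.2 hi)]

/-- **Poisson weights are nondecreasing on `[0, μ]`**: `i ≤ i'`, `i' ≤ μ` ⟹ `μ^i/i! ≤ μ^{i'}/i'!`. [folklore] -/
theorem poissonWeight_mono {μ : ℝ} (hμ : 0 < μ) {i i' : ℕ} (hii' : i ≤ i') (hi' : (i' : ℝ) ≤ μ) :
    μ ^ i / (Nat.factorial i : ℝ) ≤ μ ^ i' / (Nat.factorial i' : ℝ) := by
  obtain ⟨d, rfl⟩ := Nat.exists_eq_add_of_le hii'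
  induction d with
  | zero => simp
  | succ d ih =>
    have h1 : ((i + d : ℕ) : ℝ) + 1 ≤ μ := by push_cast at hi' ⊢; linarith
    have h2 : ((i + d : ℕ) : ℝ) ≤ μ := by linarith
    exact (ih (Nat.le_add_right i d) h2).trans (by rw [← Nat.add_assoc]; exact poissonWeight_step hμ (i + d) h1)

/-! ### The vertex law `λ·Poisson(μ)|[t,n] ⊕ (1−λ)·δ_{b*}` -/

section VertexLaw

variable (t n bs : ℕ) (μ : ℝ)

/-- `Z = Σ_{i=t}^{n} μ^i/i! > 0` (for `t ≤ n`, `μ > 0`). [folklore] -/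
theorem vertexLaw_Z_pos (hμ : 0 < μ) (htn : t ≤ n) :
    0 < ∑ i ∈ Finset.Ico t (n + 1), μ ^ i / (Nat.factorial i : ℝ) :=
  Finset.sum_pos (fun i _ => poissonWeight_pos hμ i) ⟨t, Finset.mem_Ico.2 ⟨le_rfl, Nat.lt_succ_of_le htn⟩⟩

/-- `M = Σ_{i=t}^{n} i·μ^i/i! ≤ n·Z ≤ μ·Z`. [folklore] -/
theorem vertexLaw_M_le (hμ : 0 < μ) (hnμ : (n : ℝ) ≤ μ) :
    ∑ i ∈ Finset.Ico t (n + 1), (i : ℝ) * (μ ^ i / (Nat.factorial i : ℝ)) ≤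
      μ * ∑ i ∈ Finset.Ico t (n + 1), μ ^ i / (Nat.factorial i : ℝ) := by
  rw [Finset.mul_sum]
  refine Finset.sum_le_sum fun i hi => ?_
  have hin : (i : ℝ) ≤ n := by exact_mod_cast Nat.le_of_lt_succ (Finset.mem_Ico.1 hi).2
  exact mul_le_mul_of_nonneg_right (hin.trans hnμ) (poissonWeight_pos hμ i).le

/-- **Evaluation of the vertex law against a test function.**  With `Z, M` as above, `λ = (b* − μ)Z/(b*Z − M)` and
`Y b = λ μ^b/(b! Z)` on `[t, n]`, `Y b* = 1 − λ`, `0` elsewhere (`n < b*`):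
`Σ_{b ≤ b*} Y b·φ b = (λ/Z)·Σ_{i=t}^{n} μ^i/i!·φ i + (1 − λ)·φ b*`. [this work] -/
theorem vertexLaw_eval (hnbs : n < bs) (lam Z : ℝ) (φ : ℕ → ℝ) :
    ∑ b ∈ Finset.range (bs + 1),
        (if t ≤ b ∧ b ≤ n then lam * (μ ^ b / (Nat.factorial b : ℝ)) / Z else if b = bs then 1 - lam else 0) * φ b =
      lam / Z * ∑ i ∈ Finset.Ico t (n + 1), μ ^ i / (Nat.factorial i : ℝ) * φ i + (1 - lam) * φ bs := by
  -- split off the atom `b*` and restrict the rest to `[t, n]`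
  rw [Finset.sum_range_succ]
  have hatom : (if t ≤ bs ∧ bs ≤ n then lam * (μ ^ bs / (Nat.factorial bs : ℝ)) / Z else if bs = bs then 1 - lam else 0) = 1 - lam := by
    rw [if_neg (by rintro ⟨_, h⟩; omega), if_pos rfl]
  rw [hatom]
  congr 1
  have hsub : Finset.Ico t (n + 1) ⊆ Finset.range bs := fun i hi => by
    rw [Finset.mem_Ico] at hi; rw [Finset.mem_range]; omega
  rw [← Finset.sum_subset hsub (fun b hb hbn => by
    have hb' : b < bs := Finset.mem_range.1 hb
    have : ¬ (t ≤ b ∧ b ≤ n) := fun h => hbn (Finset.mem_Ico.2 ⟨h.1, Nat.lt_succ_of_le h.2⟩)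
    rw [if_neg this, if_neg (by omega), zero_mul])]
  rw [Finset.mul_sum]
  refine Finset.sum_congr rfl fun i hi => ?_
  have h : t ≤ i ∧ i ≤ n := ⟨(Finset.mem_Ico.1 hi).1, Nat.le_of_lt_succ (Finset.mem_Ico.1 hi).2⟩
  rw [if_pos h]
  ring

/-- The vertex law is nonnegative (`0 ≤ λ ≤ 1`, `Z > 0`). [this work] -/
theorem vertexLaw_nonneg (lam Z : ℝ) (hlam0 : 0 ≤ lam) (hlam1 : lam ≤ 1) (hZ : 0 < Z) (hμ : 0 < μ) (b : ℕ) :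
    0 ≤ (if t ≤ b ∧ b ≤ n then lam * (μ ^ b / (Nat.factorial b : ℝ)) / Z else if b = bs then 1 - lam else 0) := by
  split_ifs
  · exact div_nonneg (mul_nonneg hlam0 (poissonWeight_pos hμ b).le) hZ.le
  · linarith
  · exact le_rfl

/-- The vertex law is ratio-regular below `μ` when `n = ⌊μ⌋` (`n ≤ μ < n+1`): `μ·Y(b−1) = b·Y b` inside the bump, `Y` vanishes below `t`, and the
atom sits above `μ`. [this work] -/
theorem vertexLaw_ratio (hμn : μ < (n : ℝ) + 1) (hμbs : μ < bs) (lam Z : ℝ) (hlam0 : 0 ≤ lam)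
    (hZ : 0 < Z) (hμ : 0 < μ) (b : ℕ) (hb1 : 1 ≤ b) (hbμ : (b : ℝ) ≤ μ) :
    μ * (if t ≤ b - 1 ∧ b - 1 ≤ n then lam * (μ ^ (b - 1) / (Nat.factorial (b - 1) : ℝ)) / Z else if b - 1 = bs then 1 - lam else 0) ≤
      (b : ℝ) * (if t ≤ b ∧ b ≤ n then lam * (μ ^ b / (Nat.factorial b : ℝ)) / Z else if b = bs then 1 - lam else 0) := by
  have hbbs : b ≠ bs := by
    intro h; rw [h] at hbμ; linarith
  have hb1bs : b - 1 ≠ bs := by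
    intro h
    have : (bs : ℝ) ≤ μ := by
      have : ((b - 1 : ℕ) : ℝ) ≤ b := by exact_mod_cast Nat.sub_le b 1
      rw [h] at this; linarith
    linarith
  by_cases hb : t ≤ b ∧ b ≤ n
  · rw [if_pos hb]
    by_cases hb' : t ≤ b - 1 ∧ b - 1 ≤ n
    · rw [if_pos hb']
      -- `μ·μ^{b-1}/(b-1)! = b·μ^b/b!`
      obtain ⟨c, rfl⟩ : ∃ c, b = c + 1 := ⟨b - 1, by omega⟩
      simp only [Nat.add_sub_cancel]
      have hf : (Nat.factorial (c + 1) : ℝ) = ((c : ℝ) + 1) * (Nat.factorial c : ℝ) := by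
        rw [Nat.factorial_succ]; push_cast; ring
      have hfc : (0 : ℝ) < (Nat.factorial c : ℝ) := by exact_mod_cast Nat.factorial_pos c
      rw [hf, pow_succ]
      push_cast
      rw [show μ * (lam * (μ ^ c / (Nat.factorial c : ℝ)) / Z) =
          ((c : ℝ) + 1) * (lam * (μ ^ c * μ / (((c : ℝ) + 1) * (Nat.factorial c : ℝ))) / Z) from by
        field_simp]
    · rw [if_neg hb', if_neg hb1bs, mul_zero]
      exact mul_nonneg (Nat.cast_nonneg b) (div_nonneg (mul_nonneg hlam0 (poissonWeight_pos hμ b).le) hZ.le)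
  · rw [if_neg hb, if_neg hbbs, mul_zero]
    by_cases hb' : t ≤ b - 1 ∧ b - 1 ≤ n
    · -- then `b = n + 1 > μ` (as `μ < n + 1`), contradicting `b ≤ μ`
      exfalso
      have hbn : b = n + 1 := by omega
      have : (b : ℝ) = n + 1 := by rw [hbn]; push_cast; ring
      linarith
    · rw [if_neg hb', if_neg hb1bs, mul_zero]

/-- `λ = (b* − μ)Z/(b*Z − M)` lies in `(0, 1]` (`M ≤ μZ < b*Z`). [this work] -/
theorem vertexLaw_lam_bounds (hμ : 0 < μ) (htn : t ≤ n) (hnμ : (n : ℝ) ≤ μ) (hμbs : μ < bs) (Z M lam : ℝ)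
    (hZ : Z = ∑ i ∈ Finset.Ico t (n + 1), μ ^ i / (Nat.factorial i : ℝ))
    (hM : M = ∑ i ∈ Finset.Ico t (n + 1), (i : ℝ) * (μ ^ i / (Nat.factorial i : ℝ)))
    (hlam : lam = ((bs : ℝ) - μ) * Z / ((bs : ℝ) * Z - M)) :
    0 < (bs : ℝ) * Z - M ∧ 0 < lam ∧ lam ≤ 1 := by
  have hZpos : 0 < Z := by rw [hZ]; exact vertexLaw_Z_pos t n μ hμ htn
  have hMle : M ≤ μ * Z := by rw [hM, hZ]; exact vertexLaw_M_le t n μ hμ hnμ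
  have hD : 0 < (bs : ℝ) * Z - M := by nlinarith
  refine ⟨hD, ?_, ?_⟩
  · rw [hlam]; exact div_pos (mul_pos (by linarith) hZpos) hD
  · rw [hlam, div_le_one hD]; nlinarith

/-- The vertex law has total mass one. [this work] -/
theorem vertexLaw_sum (hnbs : n < bs) (Z lam : ℝ) (hZ : Z = ∑ i ∈ Finset.Ico t (n + 1), μ ^ i / (Nat.factorial i : ℝ)) (hZ0 : Z ≠ 0) :
    ∑ b ∈ Finset.range (bs + 1),
        (if t ≤ b ∧ b ≤ n then lam * (μ ^ b / (Nat.factorial b : ℝ)) / Z else if b = bs then 1 - lam else 0) = 1 := by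
  have h := vertexLaw_eval t n bs μ hnbs lam Z (fun _ => (1 : ℝ))
  simp only [mul_one] at h
  rw [h, ← hZ, div_mul_cancel₀ _ hZ0]
  ring

/-- The vertex law has mean `μ`. [this work] -/
theorem vertexLaw_mean (hnbs : n < bs) (Z M lam : ℝ)
    (hM : M = ∑ i ∈ Finset.Ico t (n + 1), (i : ℝ) * (μ ^ i / (Nat.factorial i : ℝ))) (hZ0 : Z ≠ 0) (hD : (bs : ℝ) * Z - M ≠ 0)
    (hlam : lam = ((bs : ℝ) - μ) * Z / ((bs : ℝ) * Z - M)) :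
    ∑ b ∈ Finset.range (bs + 1),
        (b : ℝ) * (if t ≤ b ∧ b ≤ n then lam * (μ ^ b / (Nat.factorial b : ℝ)) / Z else if b = bs then 1 - lam else 0) = μ := by
  have h := vertexLaw_eval t n bs μ hnbs lam Z (fun b => (b : ℝ))
  rw [Finset.sum_congr rfl fun b _ => mul_comm _ _] at h
  rw [h]
  have hM' : ∑ i ∈ Finset.Ico t (n + 1), μ ^ i / (Nat.factorial i : ℝ) * (i : ℝ) = M := by
    rw [hM]; exact Finset.sum_congr rfl fun i _ => mul_comm _ _
  rw [hM', hlam]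
  field_simp
  ring

/-- The expectation of `ℓ` under the vertex law. [this work] -/
theorem vertexLaw_expectation (hnbs : n < bs) (Z lam : ℝ) (ℓ : ℕ → ℝ) :
    ∑ b ∈ Finset.range (bs + 1),
        (if t ≤ b ∧ b ≤ n then lam * (μ ^ b / (Nat.factorial b : ℝ)) / Z else if b = bs then 1 - lam else 0) * ℓ b =
      lam / Z * ∑ i ∈ Finset.Ico t (n + 1), μ ^ i / (Nat.factorial i : ℝ) * ℓ i + (1 - lam) * ℓ bs :=
  vertexLaw_eval t n bs μ hnbs lam Z ℓ

/-- **The tail inequality for the price `U = (ℓ b* − τ)/(b* − μ)` is the profile inequality for the vertex law.**  If `τ ≤ E_Y ℓ` then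
`0 ≤ Σ_{i=t}^{n} (ℓ i − τ − U·(i − μ))·μ^i/i!`. [this work] -/
theorem poissonTail_nonneg_of_vertexLaw (hμ : 0 < μ) (htn : t ≤ n) (hnμ : (n : ℝ) ≤ μ) (hμbs : μ < bs) (τ : ℝ) (ℓ : ℕ → ℝ)
    (Z M lam : ℝ) (hZ : Z = ∑ i ∈ Finset.Ico t (n + 1), μ ^ i / (Nat.factorial i : ℝ))
    (hM : M = ∑ i ∈ Finset.Ico t (n + 1), (i : ℝ) * (μ ^ i / (Nat.factorial i : ℝ)))
    (hlam : lam = ((bs : ℝ) - μ) * Z / ((bs : ℝ) * Z - M))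
    (hY : τ ≤ lam / Z * ∑ i ∈ Finset.Ico t (n + 1), μ ^ i / (Nat.factorial i : ℝ) * ℓ i + (1 - lam) * ℓ bs) :
    0 ≤ ∑ i ∈ Finset.Ico t (n + 1), (ℓ i - τ - (ℓ bs - τ) / ((bs : ℝ) - μ) * ((i : ℝ) - μ)) * (μ ^ i / (Nat.factorial i : ℝ)) := by
  obtain ⟨hD, hlam0, _⟩ := vertexLaw_lam_bounds t n bs μ hμ htn hnμ hμbs Z M lam hZ hM hlam
  have hZpos : 0 < Z := by rw [hZ]; exact vertexLaw_Z_pos t n μ hμ htn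
  have hbμ : 0 < (bs : ℝ) - μ := by linarith
  set A := ∑ i ∈ Finset.Ico t (n + 1), μ ^ i / (Nat.factorial i : ℝ) * ℓ i with hA
  -- the sum in closed form: `A − τ Z − U (M − μ Z)`
  have hclosed : ∑ i ∈ Finset.Ico t (n + 1), (ℓ i - τ - (ℓ bs - τ) / ((bs : ℝ) - μ) * ((i : ℝ) - μ)) * (μ ^ i / (Nat.factorial i : ℝ)) =
      A - τ * Z - (ℓ bs - τ) / ((bs : ℝ) - μ) * (M - μ * Z) := by
    rw [hA, hZ, hM]
    simp only [Finset.mul_sum, ← Finset.sum_sub_distrib]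
    exact Finset.sum_congr rfl fun i _ => by ring
  rw [hclosed]
  -- `τ·(b*Z − M) ≤ (b* − μ)A + (μZ − M)ℓ b*`
  have h1 : (1 - lam) = (μ * Z - M) / ((bs : ℝ) * Z - M) := by
    rw [hlam]; field_simp; ring
  have h2 : lam / Z = ((bs : ℝ) - μ) / ((bs : ℝ) * Z - M) := by
    rw [hlam]; field_simp
  rw [h1, h2] at hY
  have hY' : τ * ((bs : ℝ) * Z - M) ≤ ((bs : ℝ) - μ) * A + (μ * Z - M) * ℓ bs := by
    have h := hY
    rw [div_mul_eq_mul_div, div_mul_eq_mul_div, ← add_div, le_div_iff₀ hD] at h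
    exact h
  -- conclude: multiply the target by `b* − μ > 0`
  have key : 0 ≤ ((bs : ℝ) - μ) * (A - τ * Z) + (ℓ bs - τ) * (μ * Z - M) := by nlinarith
  have : ((bs : ℝ) - μ) * (A - τ * Z - (ℓ bs - τ) / ((bs : ℝ) - μ) * (M - μ * Z)) =
      ((bs : ℝ) - μ) * (A - τ * Z) + (ℓ bs - τ) * (μ * Z - M) := by
    field_simp; ring
  nlinarith [this, key, hbμ]

end VertexLaw

end Quant

end Summit.CriticalPhenomena.PercolationContinuityZ3.Theorems

end
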